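import Literature.NumberTheory.Sieve.HeathBrownCubicTwistedSmallQ
import HarnessLib

/-!
# Heath-Brown's Lemma 3.10 for a twisted weight: §§12–13, the Class I cells (Möbius in `d`, main part, tail)

D. R. Heath-Brown, *Primes represented by `x³ + 2y³`*, Acta Math. 186 (2001), §12 pp. 75–77 and §13 p. 78,
for the twisted weight `F'_β(w) = w(β̂)f_(β)[β̂ primitive]` (`|w| ≤ 1`) of Heath-Brown–Moroz 2004,
Prop. 4.2 (ii): the tree's `HeathBrownCubicTypeIIClassISum` re-run word for word (characters + Cauchy are
stated there for arbitrary weights; only `|F'(w)| ≤ 9τ` and the support of `F'(w)` are used).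
PROVED: the expansion of the twisted Class I sum and its Möbius form; `|Φ_w(e)| ≤ (T₁ + T₂)/(2e²)`;
the main part `≤ ½ ∑_{q ≤ d₀} w(q)(U*₁(q) + U*₂(q))` with `U*` of the twisted weight; the tail part
`≤ 81·tailPair` (untwisted majorant); `abs_classISum_le`; and the sum over all pairs of hypercubes
`sum_abs_classISum_le`.

## References

* D. R. Heath-Brown, Acta Math. 186 (2001), §§12–13 pp. 75–78. [cite: HeathBrownActa2001, Lemma 12.1]
* D. R. Heath-Brown, B. Z. Moroz, Proc. London Math. Soc. 88 (2004), Prop. 4.2. [cite: HeathBrownMoroz2004, Proposition 4.2]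

## Mathlib / tree search

Tree: `HeathBrownCubicTypeIIClassISum` (all statements, d = 1), `HeathBrownCubicTypeIICharSum`
(`abs_sum_dvd_cross3_le`, generic weights), `HeathBrownCubicTypeIIWeights` (`wt`, `Ustar`, `sum_pairs_Tsum_le`),
`HeathBrownCubicTypeIITail` (`tailPair`, `TL`, `sum_tailPair_le_TL`).
-/

noncomputable section

open Finset NumberField ArithmeticFunction

open scoped ArithmeticFunction.Moebius ArithmeticFunction.sigma

namespace Literature.NumberTheory.Sieve.CubicSieve.Twisted

open LFunctions.CubeRootTwoField CubicPrimes CubicSieve LargeSieve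

variable {X η τ V T : ℝ} {k : ℕ} {m : Fin k → ℕ} {w : ℤ × ℤ × ℤ → ℝ} {N : ℕ} {Δ₀ : ℝ}

/-! ### The expansion of the Class I sum -/

open scoped Classical in
/-- `∑_{t ∈ TI} S₆(t) = ∑_{(β̂₁,β̂₂) ∈ C₁×C₂} F'₁F'₂ · [Δ₀ < h.c.f., cell(h.c.f.) ∈ TI]`. [cite: HeathBrownActa2001, Lemma 12.1] -/
theorem classISum_eq_sum_pairs (n n' : ℤ × ℤ × ℤ) :
    classISum X η τ m V T w N Δ₀ n n' =
      ∑ bb ∈ LC (T / N) n ×ˢ LC (T / N) n', Fprim X τ m w bb.1 * Fprim X τ m w bb.2 *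
        (if Δ₀ < (hcf3 (cross3 bb.1 bb.2) : ℝ) ∧ tIdx N (hcf3 (cross3 bb.1 bb.2)) ∈ TI X η V T N Δ₀ n n'
          then 1 else 0) := by
  classical
  rw [classISum]
  simp only [S6]
  set F := (LC (T / N) n ×ˢ LC (T / N) n').filter (fun bb => IsPrimitiveVec bb.1 ∧ IsPrimitiveVec bb.2 ∧
      Δ₀ < (Dhcf bb : ℝ) ∧ tIdx N (Dhcf bb) ∈ TI X η V T N Δ₀ n n') with hF
  have hfib : ∀ t ∈ TI X η V T N Δ₀ n n',
      (LC (T / N) n ×ˢ LC (T / N) n').filter (fun bb => IsPrimitiveVec bb.1 ∧ IsPrimitiveVec bb.2 ∧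
        Δ₀ < (Dhcf bb : ℝ) ∧ tIdx N (Dhcf bb) = t) = F.filter (fun bb => tIdx N (Dhcf bb) = t) := by
    intro t ht
    rw [hF, filter_filter]
    refine filter_congr fun bb _ => ?_
    constructor
    · rintro ⟨h1, h2, h3, h4⟩; exact ⟨⟨h1, h2, h3, by rw [h4]; exact ht⟩, h4⟩
    · rintro ⟨⟨h1, h2, h3, -⟩, h4⟩; exact ⟨h1, h2, h3, h4⟩
  rw [sum_congr rfl fun t ht => by rw [hfib t ht]]
  rw [sum_fiberwise_of_maps_to (g := fun bb => tIdx N (Dhcf bb)) (fun bb hbb => by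
    rw [hF, mem_filter] at hbb; exact hbb.2.2.2.2)]
  rw [hF, sum_filter]
  refine sum_congr rfl fun bb _ => ?_
  simp only [Dhcf, Fprim_def, CubicSieve.Fprim]
  by_cases hp1 : IsPrimitiveVec bb.1
  · by_cases hp2 : IsPrimitiveVec bb.2
    · simp only [hp1, hp2, true_and, if_true]
      split_ifs <;> ring
    · simp [hp1, hp2]
  · simp [hp1]

open scoped Classical in
/-- **Möbius expansion of the Class I sum** (good, distinct hypercubes):
`∑_{t ∈ TI} S₆(t) = ∑_{D ∈ 𝒟} ∑_{d ≤ H} μ(d) Φ(dD)`, `𝒟 = {D ≤ H : Δ₀ < D, cell(D) ∈ TI}`, `H = ⌊18T²⌋₊ + 1`.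
[cite: HeathBrownActa2001, §12 p. 75] -/
theorem classISum_eq_moebius (hT : 0 < T) (hTV : T ^ 3 = V) {n n' : ℤ × ℤ × ℤ}
    (hg : goodCube V T N n) (hg' : goodCube V T N n') (hnn : n ≠ n') (hN : 0 < N) :
    classISum X η τ m V T w N Δ₀ n n' =
      ∑ D ∈ (Icc 1 (⌊18 * T ^ 2⌋₊ + 1)).filter (fun D : ℕ => Δ₀ < (D : ℝ) ∧ tIdx N D ∈ TI X η V T N Δ₀ n n'),
        ∑ d ∈ Icc 1 (⌊18 * T ^ 2⌋₊ + 1), (μ d : ℝ) * PhiSum X τ m T w N n n' (d * D) := by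
  classical
  have hNR : (0 : ℝ) < N := by exact_mod_cast hN
  have hs : 0 < T / N := by positivity
  set H : ℕ := ⌊18 * T ^ 2⌋₊ + 1 with hH
  set 𝒟 := (Icc 1 H).filter (fun D : ℕ => Δ₀ < (D : ℝ) ∧ tIdx N D ∈ TI X η V T N Δ₀ n n') with h𝒟
  rw [classISum_eq_sum_pairs]
  -- pointwise identity
  have hpt : ∀ bb ∈ LC (T / N) n ×ˢ LC (T / N) n',
      Fprim X τ m w bb.1 * Fprim X τ m w bb.2 *
        (if Δ₀ < (hcf3 (cross3 bb.1 bb.2) : ℝ) ∧ tIdx N (hcf3 (cross3 bb.1 bb.2)) ∈ TI X η V T N Δ₀ n n' then 1 else 0) =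
      ∑ D ∈ 𝒟, ∑ d ∈ Icc 1 H, (μ d : ℝ) *
        (if DvdVec ((d * D : ℕ) : ℤ) (cross3 bb.1 bb.2) then Fprim X τ m w bb.1 * Fprim X τ m w bb.2 else 0) := by
    intro bb hbb
    by_cases hz : Fprim X τ m w bb.1 * Fprim X τ m w bb.2 = 0
    · rw [hz, zero_mul]
      symm; refine sum_eq_zero fun D _ => sum_eq_zero fun d _ => ?_
      simp
    · have hp1 : IsPrimitiveVec bb.1 := prim_of_Fprim_ne_zero (left_ne_zero_of_mul hz)
      have hp2 : IsPrimitiveVec bb.2 := prim_of_Fprim_ne_zero (right_ne_zero_of_mul hz)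
      rw [mem_product] at hbb
      obtain ⟨-, hB1, -, -, hell1, -⟩ := good_point_facts hT hTV hN hg hbb.1
      obtain ⟨-, hB2, -, -, hell2, -⟩ := good_point_facts hT hTV hN hg' hbb.2
      have hne : bb.1 ≠ bb.2 := by
        intro h
        have h1 := (mem_LC_iff hs).mp hbb.1
        have h2 := (mem_LC_iff hs).mp hbb.2
        rw [h] at h1; exact hnn (h1.symm.trans h2)
      have hv : cross3 bb.1 bb.2 ≠ 0 := cross3_ne_zero_of_ne hp1 hp2 hne hell1 hell2
      have h1 : 1 ≤ hcf3 (cross3 bb.1 bb.2) := one_le_hcf3 hv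
      have hHv : hcf3 (cross3 bb.1 bb.2) ≤ H := hcf3_cross3_le hT hB1 hB2 hv
      rw [indicator_cond_eq_sum h1 hHv (fun D : ℕ => Δ₀ < (D : ℝ) ∧ tIdx N D ∈ TI X η V T N Δ₀ n n'), ← h𝒟,
        mul_sum]
      refine sum_congr rfl fun D hD => ?_
      rw [h𝒟, mem_filter, mem_Icc] at hD
      rw [moebius_hcf_indicator hv hD.1.1 hHv, mul_sum]
      refine sum_congr rfl fun d _ => ?_
      split_ifs <;> ring
  rw [sum_congr rfl hpt, Finset.sum_comm]
  refine sum_congr rfl fun D _ => ?_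
  rw [Finset.sum_comm]
  refine sum_congr rfl fun d _ => ?_
  rw [PhiSum, ← mul_sum, sum_product]

/-- **`|Φ(e)| ≤ (T₁(e) + T₂(e))/(2e²)`** (characters and Cauchy). [cite: HeathBrownActa2001, §13 p. 78] -/
theorem abs_PhiSum_le {e : ℕ} (he : 0 < e) (n n' : ℤ × ℤ × ℤ) :
    |PhiSum X τ m T w N n n' e| ≤
      (Tsum (Fprim X τ m w) (LC (T / N) n) e + Tsum (Fprim X τ m w) (LC (T / N) n') e) / (2 * (e : ℝ) ^ 2) := by
  classical
  rw [PhiSum]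
  exact abs_sum_dvd_cross3_le he _ _ (fun v hv => prim_of_Fprim_ne_zero hv) (fun v hv => prim_of_Fprim_ne_zero hv) _ _

open scoped Classical in
/-- **The main part**: `|∑_{D ∈ 𝒟} ∑_{d ≤ min(H, d₀/D)} μ(d)Φ(dD)| ≤ ½ ∑_{q ≤ d₀} w(q)(U*₁(q) + U*₂(q))`.
[cite: HeathBrownActa2001, §13 (13.2)] -/
theorem abs_mainPart_le (hX : 0 < X) (hVX : X ≤ 270 * V) (hN : 0 < N) {d₀ : ℝ} (hd₀ : 0 ≤ d₀) {H : ℕ}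
    (n n' : ℤ × ℤ × ℤ) :
    |∑ D ∈ (Icc 1 H).filter (fun D : ℕ => Δ₀ < (D : ℝ) ∧ tIdx N D ∈ TI X η V T N Δ₀ n n'),
        ∑ d ∈ (Icc 1 H).filter (fun d : ℕ => d ≤ ⌊d₀ / D⌋₊), (μ d : ℝ) * PhiSum X τ m T w N n n' (d * D)| ≤
      (∑ q ∈ Icc 1 ⌊d₀⌋₊, wt Δ₀ ⌊810 * V / X⌋₊ d₀ q * Ustar (Fprim X τ m w) (LC (T / N) n) q +
        ∑ q ∈ Icc 1 ⌊d₀⌋₊, wt Δ₀ ⌊810 * V / X⌋₊ d₀ q * Ustar (Fprim X τ m w) (LC (T / N) n') q) / 2 := by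
  classical
  set F := Fprim X τ m w with hF
  set C₁ := LC (T / N) n with hC₁
  set C₂ := LC (T / N) n' with hC₂
  set 𝒟 := (Icc 1 H).filter (fun D : ℕ => Δ₀ < (D : ℝ) ∧ tIdx N D ∈ TI X η V T N Δ₀ n n') with h𝒟
  set SD := (Icc 1 ⌊810 * V / X⌋₊).filter (fun D : ℕ => Δ₀ < (D : ℝ)) with hSD
  have hsub : 𝒟 ⊆ SD := by
    intro D hD
    rw [h𝒟, mem_filter, mem_Icc] at hD
    obtain ⟨⟨hD1, -⟩, hΔD, ht⟩ := hD
    rw [hSD, mem_filter, mem_Icc]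
    refine ⟨⟨hD1, ?_⟩, hΔD⟩
    rw [TI, mem_filter] at ht
    exact le_Dmax_of_tIdx_mem_Trange hX hVX hN hD1 ht.1
  -- termwise bound
  have hterm : ∀ D ∈ 𝒟, ∀ d : ℕ, 1 ≤ d →
      |(μ d : ℝ) * PhiSum X τ m T w N n n' (d * D)| ≤
        (((d * D : ℕ) : ℝ) ^ 2)⁻¹ * Tsum F C₁ (d * D) / 2 + (((d * D : ℕ) : ℝ) ^ 2)⁻¹ * Tsum F C₂ (d * D) / 2 := by
    intro D hD d hd
    rw [h𝒟, mem_filter, mem_Icc] at hD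
    have hdD : 0 < d * D := Nat.mul_pos (by omega) (by omega)
    have hμ : |(μ d : ℝ)| ≤ 1 := by exact_mod_cast ArithmeticFunction.abs_moebius_le_one
    have hΦ := abs_PhiSum_le (X := X) (τ := τ) (m := m) (T := T) (w := w) (N := N) hdD n n'
    rw [abs_mul]
    calc |(μ d : ℝ)| * |PhiSum X τ m T w N n n' (d * D)| ≤ 1 * |PhiSum X τ m T w N n n' (d * D)| := by
          gcongr
      _ ≤ (Tsum F C₁ (d * D) + Tsum F C₂ (d * D)) / (2 * (((d * D : ℕ)) : ℝ) ^ 2) := by rw [one_mul]; exact hΦ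
      _ = _ := by
          have : (0 : ℝ) < ((d * D : ℕ) : ℝ) := by exact_mod_cast hdD
          field_simp
  calc |∑ D ∈ 𝒟, ∑ d ∈ (Icc 1 H).filter (fun d : ℕ => d ≤ ⌊d₀ / D⌋₊), (μ d : ℝ) * PhiSum X τ m T w N n n' (d * D)|
      ≤ ∑ D ∈ 𝒟, |∑ d ∈ (Icc 1 H).filter (fun d : ℕ => d ≤ ⌊d₀ / D⌋₊), (μ d : ℝ) * PhiSum X τ m T w N n n' (d * D)| :=
        abs_sum_le_sum_abs _ _
    _ ≤ ∑ D ∈ 𝒟, ∑ d ∈ (Icc 1 H).filter (fun d : ℕ => d ≤ ⌊d₀ / D⌋₊), |(μ d : ℝ) * PhiSum X τ m T w N n n' (d * D)| :=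
        sum_le_sum fun D _ => abs_sum_le_sum_abs _ _
    _ ≤ ∑ D ∈ 𝒟, ∑ d ∈ Icc 1 ⌊d₀ / D⌋₊, |(μ d : ℝ) * PhiSum X τ m T w N n n' (d * D)| := by
        refine sum_le_sum fun D _ => sum_le_sum_of_subset_of_nonneg (fun d hd => ?_) (fun _ _ _ => abs_nonneg _)
        rw [mem_filter, mem_Icc] at hd; rw [mem_Icc]; exact ⟨hd.1.1, hd.2⟩
    _ ≤ ∑ D ∈ 𝒟, ∑ d ∈ Icc 1 ⌊d₀ / D⌋₊,
          ((((d * D : ℕ) : ℝ) ^ 2)⁻¹ * Tsum F C₁ (d * D) / 2 + (((d * D : ℕ) : ℝ) ^ 2)⁻¹ * Tsum F C₂ (d * D) / 2) := by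
        refine sum_le_sum fun D hD => sum_le_sum fun d hd => ?_
        rw [mem_Icc] at hd
        exact hterm D hD d hd.1
    _ ≤ ∑ D ∈ SD, ∑ d ∈ Icc 1 ⌊d₀ / D⌋₊,
          ((((d * D : ℕ) : ℝ) ^ 2)⁻¹ * Tsum F C₁ (d * D) / 2 + (((d * D : ℕ) : ℝ) ^ 2)⁻¹ * Tsum F C₂ (d * D) / 2) := by
        refine sum_le_sum_of_subset_of_nonneg hsub fun D _ _ => sum_nonneg fun d _ => ?_
        have := Tsum_nonneg F C₁ (d * D); have := Tsum_nonneg F C₂ (d * D)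
        positivity
    _ = (∑ D ∈ SD, ∑ d ∈ Icc 1 ⌊d₀ / D⌋₊, (((d * D : ℕ) : ℝ) ^ 2)⁻¹ * Tsum F C₁ (d * D) +
          ∑ D ∈ SD, ∑ d ∈ Icc 1 ⌊d₀ / D⌋₊, (((d * D : ℕ) : ℝ) ^ 2)⁻¹ * Tsum F C₂ (d * D)) / 2 := by
        rw [← sum_add_distrib, sum_div]
        refine sum_congr rfl fun D _ => ?_
        rw [← sum_add_distrib, sum_div]
        refine sum_congr rfl fun d _ => ?_
        ring
    _ ≤ _ := by
        gcongr
        · exact sum_pairs_Tsum_le hd₀ _ F C₁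
        · exact sum_pairs_Tsum_le hd₀ _ F C₂

open scoped Classical in
/-- **The tail part**: `|∑_{D ∈ 𝒟} ∑_{d > d₀/D} μ(d)Φ(dD)| ≤ 81 · tailPair` (good, distinct hypercubes).
[cite: HeathBrownActa2001, §12 pp. 75–76] -/
theorem abs_tailPart_le (hw : ∀ b, |w b| ≤ 1) (hX : 1 < X) (hτ : 0 < τ) (hτ1 : τ ≤ 1) {nn : ℕ} {m : Fin (nn + 1) → ℕ}
    (hm : CoreAdmissible τ m) (hT : 0 < T) (hTV : T ^ 3 = V) (hN : 0 < N) {d₀ : ℝ} (hd₀ : 0 ≤ d₀)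
    {n n' : ℤ × ℤ × ℤ} (hg : goodCube V T N n) (hg' : goodCube V T N n') (hnn : n ≠ n') (𝒟 : Finset ℕ) (H : ℕ) :
    |∑ D ∈ 𝒟, ∑ d ∈ (Icc 1 H).filter (fun d : ℕ => ¬d ≤ ⌊d₀ / D⌋₊), (μ d : ℝ) * PhiSum X τ m T w N n n' (d * D)| ≤
      81 * tailPair T N d₀ n n' := by
  classical
  have hNR : (0 : ℝ) < N := by exact_mod_cast hN
  have hs : 0 < T / N := by positivity
  set C₁ := LC (T / N) n with hC₁
  set C₂ := LC (T / N) n' with hC₂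
  set F := Fprim X τ m w with hF
  -- the nonnegative majorant `G(D, d, bb) = |F'F'| [dD ∣ v]`
  set G : ℕ → ℕ → (ℤ × ℤ × ℤ) × (ℤ × ℤ × ℤ) → ℝ := fun D d bb =>
    |F bb.1 * F bb.2| * (if DvdVec ((d * D : ℕ) : ℤ) (cross3 bb.1 bb.2) then (1 : ℝ) else 0) with hG
  -- Step 1
  have step1 : |∑ D ∈ 𝒟, ∑ d ∈ (Icc 1 H).filter (fun d : ℕ => ¬d ≤ ⌊d₀ / D⌋₊), (μ d : ℝ) * PhiSum X τ m T w N n n' (d * D)| ≤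
      ∑ D ∈ 𝒟, ∑ d ∈ (Icc 1 H).filter (fun d : ℕ => ¬d ≤ ⌊d₀ / D⌋₊), ∑ bb ∈ C₁ ×ˢ C₂, G D d bb := by
    refine (abs_sum_le_sum_abs _ _).trans (sum_le_sum fun D _ => ?_)
    refine (abs_sum_le_sum_abs _ _).trans (sum_le_sum fun d _ => ?_)
    have hμ : |(μ d : ℝ)| ≤ 1 := by exact_mod_cast ArithmeticFunction.abs_moebius_le_one
    rw [abs_mul, PhiSum, ← sum_product']
    calc |(μ d : ℝ)| * |∑ x ∈ C₁ ×ˢ C₂, (if DvdVec ((d * D : ℕ) : ℤ) (cross3 x.1 x.2) then F x.1 * F x.2 else 0)|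
        ≤ 1 * ∑ x ∈ C₁ ×ˢ C₂, |(if DvdVec ((d * D : ℕ) : ℤ) (cross3 x.1 x.2) then F x.1 * F x.2 else 0)| :=
          mul_le_mul hμ (abs_sum_le_sum_abs _ _) (abs_nonneg _) zero_le_one
      _ = ∑ bb ∈ C₁ ×ˢ C₂, G D d bb := by
          rw [one_mul]
          refine sum_congr rfl fun bb _ => ?_
          simp only [hG]
          split_ifs <;> simp
  -- Step 2: exchange
  have step2 : ∑ D ∈ 𝒟, ∑ d ∈ (Icc 1 H).filter (fun d : ℕ => ¬d ≤ ⌊d₀ / D⌋₊), ∑ bb ∈ C₁ ×ˢ C₂, G D d bb =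
      ∑ bb ∈ C₁ ×ˢ C₂, |F bb.1 * F bb.2| *
        ∑ D ∈ 𝒟, ∑ d ∈ (Icc 1 H).filter (fun d : ℕ => ¬d ≤ ⌊d₀ / D⌋₊),
          (if DvdVec ((d * D : ℕ) : ℤ) (cross3 bb.1 bb.2) then (1 : ℝ) else 0) := by
    calc ∑ D ∈ 𝒟, ∑ d ∈ (Icc 1 H).filter (fun d : ℕ => ¬d ≤ ⌊d₀ / D⌋₊), ∑ bb ∈ C₁ ×ˢ C₂, G D d bb
        = ∑ D ∈ 𝒟, ∑ bb ∈ C₁ ×ˢ C₂, ∑ d ∈ (Icc 1 H).filter (fun d : ℕ => ¬d ≤ ⌊d₀ / D⌋₊), G D d bb :=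
          sum_congr rfl fun D _ => Finset.sum_comm
      _ = ∑ bb ∈ C₁ ×ˢ C₂, ∑ D ∈ 𝒟, ∑ d ∈ (Icc 1 H).filter (fun d : ℕ => ¬d ≤ ⌊d₀ / D⌋₊), G D d bb :=
          Finset.sum_comm
      _ = _ := by
          refine sum_congr rfl fun bb _ => ?_
          rw [mul_sum]
          refine sum_congr rfl fun D _ => ?_
          rw [mul_sum]
  -- Step 3: pointwise
  have step3 : ∀ bb ∈ C₁ ×ˢ C₂,
      |F bb.1 * F bb.2| * ∑ D ∈ 𝒟, ∑ d ∈ (Icc 1 H).filter (fun d : ℕ => ¬d ≤ ⌊d₀ / D⌋₊),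
          (if DvdVec ((d * D : ℕ) : ℤ) (cross3 bb.1 bb.2) then (1 : ℝ) else 0) ≤
        if IsPrimitiveVec bb.1 ∧ IsPrimitiveVec bb.2 ∧ cross3 bb.1 bb.2 ≠ 0 ∧ d₀ < (hcf3 (cross3 bb.1 bb.2) : ℝ)
          then 81 * (tauK bb.1 * tauK bb.2 * ((σ 0 (hcf3 (cross3 bb.1 bb.2)) : ℝ)) ^ 2) else 0 := by
    intro bb hbb
    have hRHS0 : (0 : ℝ) ≤ if IsPrimitiveVec bb.1 ∧ IsPrimitiveVec bb.2 ∧ cross3 bb.1 bb.2 ≠ 0 ∧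
        d₀ < (hcf3 (cross3 bb.1 bb.2) : ℝ) then 81 * (tauK bb.1 * tauK bb.2 * ((σ 0 (hcf3 (cross3 bb.1 bb.2)) : ℝ)) ^ 2) else 0 := by
      split_ifs
      · have := tauK_nonneg bb.1; have := tauK_nonneg bb.2; positivity
      · exact le_rfl
    by_cases hz : F bb.1 * F bb.2 = 0
    · rw [hz, abs_zero, zero_mul]; exact hRHS0
    have hp1 : IsPrimitiveVec bb.1 := prim_of_Fprim_ne_zero (left_ne_zero_of_mul hz)
    have hp2 : IsPrimitiveVec bb.2 := prim_of_Fprim_ne_zero (right_ne_zero_of_mul hz)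
    rw [mem_product] at hbb
    obtain ⟨-, -, -, -, hell1, -⟩ := good_point_facts hT hTV hN hg hbb.1
    obtain ⟨-, -, -, -, hell2, -⟩ := good_point_facts hT hTV hN hg' hbb.2
    have hne : bb.1 ≠ bb.2 := by
      intro h
      have h1 := (mem_LC_iff hs).mp hbb.1
      have h2 := (mem_LC_iff hs).mp hbb.2
      rw [h] at h1; exact hnn (h1.symm.trans h2)
    have hv : cross3 bb.1 bb.2 ≠ 0 := cross3_ne_zero_of_ne hp1 hp2 hne hell1 hell2
    have hcnt := count_pairs_le hv 𝒟 H hd₀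
    have hFF : |F bb.1 * F bb.2| ≤ 81 * (tauK bb.1 * tauK bb.2) := by
      rw [abs_mul]
      have h1 := abs_Fprim_le hw hX hτ hτ1 hm bb.1
      have h2 := abs_Fprim_le hw hX hτ hτ1 hm bb.2
      calc |F bb.1| * |F bb.2| ≤ (9 * tauK bb.1) * (9 * tauK bb.2) :=
            mul_le_mul h1 h2 (abs_nonneg _) (by have := tauK_nonneg bb.1; positivity)
        _ = 81 * (tauK bb.1 * tauK bb.2) := by ring
    by_cases hcase : d₀ < (hcf3 (cross3 bb.1 bb.2) : ℝ)
    · rw [if_pos hcase] at hcnt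
      rw [if_pos ⟨hp1, hp2, hv, hcase⟩]
      have hS0 : 0 ≤ ∑ D ∈ 𝒟, ∑ d ∈ (Icc 1 H).filter (fun d : ℕ => ¬d ≤ ⌊d₀ / D⌋₊),
          (if DvdVec ((d * D : ℕ) : ℤ) (cross3 bb.1 bb.2) then (1 : ℝ) else 0) :=
        sum_nonneg fun D _ => sum_nonneg fun d _ => by positivity
      have ht0 : 0 ≤ 81 * (tauK bb.1 * tauK bb.2) := by
        have := tauK_nonneg bb.1; have := tauK_nonneg bb.2; positivity
      calc _ ≤ (81 * (tauK bb.1 * tauK bb.2)) * ((σ 0 (hcf3 (cross3 bb.1 bb.2)) : ℝ)) ^ 2 :=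
            mul_le_mul hFF hcnt hS0 ht0
        _ = _ := by ring
    · rw [if_neg hcase] at hcnt
      rw [if_neg (fun h => hcase h.2.2.2)]
      have h0 : ∑ D ∈ 𝒟, ∑ d ∈ (Icc 1 H).filter (fun d : ℕ => ¬d ≤ ⌊d₀ / D⌋₊),
          (if DvdVec ((d * D : ℕ) : ℤ) (cross3 bb.1 bb.2) then (1 : ℝ) else 0) = 0 :=
        le_antisymm hcnt (sum_nonneg fun D _ => sum_nonneg fun d _ => by positivity)
      rw [h0, mul_zero]
  -- Step 4
  refine step1.trans ?_
  rw [step2]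
  refine (sum_le_sum step3).trans (le_of_eq ?_)
  rw [← sum_filter, tailPair, mul_sum]

open scoped Classical in
/-- **`|∑_{t Class I} S₆(t, 𝐧, 𝐧')| ≤ ½ ∑_{q ≤ d₀} w(q)(U*(C(𝐧),q) + U*(C(𝐧'),q)) + 81·tailPair`**.
[cite: HeathBrownActa2001, §§12–13 pp. 75–78] -/
theorem abs_classISum_le (hw : ∀ b, |w b| ≤ 1) (hX : 1 < X) (hτ : 0 < τ) (hτ1 : τ ≤ 1) {nn : ℕ} {m : Fin (nn + 1) → ℕ}
    (hm : CoreAdmissible τ m) (hT : 0 < T) (hTV : T ^ 3 = V) (hN : 0 < N) (hVX : X ≤ 270 * V)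
    {d₀ : ℝ} (hd₀ : 0 ≤ d₀) (n n' : ℤ × ℤ × ℤ) :
    |classISum X η τ m V T w N Δ₀ n n'| ≤
      (∑ q ∈ Icc 1 ⌊d₀⌋₊, wt Δ₀ ⌊810 * V / X⌋₊ d₀ q * Ustar (Fprim X τ m w) (LC (T / N) n) q +
        ∑ q ∈ Icc 1 ⌊d₀⌋₊, wt Δ₀ ⌊810 * V / X⌋₊ d₀ q * Ustar (Fprim X τ m w) (LC (T / N) n') q) / 2 +
      81 * tailPair T N d₀ n n' := by
  classical
  have hX0 : 0 < X := by linarith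
  have hA0 : ∀ n₀ : ℤ × ℤ × ℤ, 0 ≤ ∑ q ∈ Icc 1 ⌊d₀⌋₊, wt Δ₀ ⌊810 * V / X⌋₊ d₀ q * Ustar (Fprim X τ m w) (LC (T / N) n₀) q :=
    fun n₀ => sum_nonneg fun q _ => mul_nonneg (wt_nonneg _ _ _ _) (Ustar_nonneg _ _ _)
  have ht0 := tailPair_nonneg T N d₀ n n'
  by_cases hTI : TI X η V T N Δ₀ n n' = ∅
  · have : classISum X η τ m V T w N Δ₀ n n' = 0 := by rw [classISum, hTI, sum_empty]
    rw [this, abs_zero]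
    exact add_nonneg (div_nonneg (add_nonneg (hA0 n) (hA0 n')) (by norm_num)) (mul_nonneg (by norm_num) ht0)
  obtain ⟨t, ht⟩ := nonempty_iff_ne_empty.mpr hTI
  rw [TI, mem_filter] at ht
  obtain ⟨hg, hg', hnn⟩ := goodCube_of_classI (η := η) hX0 hT hN ht.2
  rw [classISum_eq_moebius hT hTV hg hg' hnn hN]
  set H : ℕ := ⌊18 * T ^ 2⌋₊ + 1 with hH
  set 𝒟 := (Icc 1 H).filter (fun D : ℕ => Δ₀ < (D : ℝ) ∧ tIdx N D ∈ TI X η V T N Δ₀ n n') with h𝒟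
  have hsplit : ∑ D ∈ 𝒟, ∑ d ∈ Icc 1 H, (μ d : ℝ) * PhiSum X τ m T w N n n' (d * D) =
      ∑ D ∈ 𝒟, ∑ d ∈ (Icc 1 H).filter (fun d : ℕ => d ≤ ⌊d₀ / D⌋₊), (μ d : ℝ) * PhiSum X τ m T w N n n' (d * D) +
      ∑ D ∈ 𝒟, ∑ d ∈ (Icc 1 H).filter (fun d : ℕ => ¬d ≤ ⌊d₀ / D⌋₊), (μ d : ℝ) * PhiSum X τ m T w N n n' (d * D) := by
    rw [← sum_add_distrib]
    refine sum_congr rfl fun D _ => ?_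
    rw [sum_filter_add_sum_filter_not]
  rw [hsplit]
  refine (abs_add_le _ _).trans (add_le_add ?_ ?_)
  · exact abs_mainPart_le hX0 hVX hN hd₀ n n'
  · exact abs_tailPart_le hw hX hτ hτ1 hm hT hTV hN hd₀ hg hg' hnn 𝒟 H

open scoped Classical in
/-- **The Class I cells, summed over all pairs of hypercubes**:
`∑_{(𝐧,𝐧') ∈ Nrange²} |∑_{t Class I} S₆(t,𝐧,𝐧')| ≤ #Nrange · ∑_{𝐧 good} ∑_{q ≤ d₀} w(q) U*(C(𝐧), q) + 81·TL(T, d₀)`.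
[cite: HeathBrownActa2001, §§12–13 pp. 75–78] -/
theorem sum_abs_classISum_le (hw : ∀ b, |w b| ≤ 1) (hX : 1 < X) (hτ : 0 < τ) (hτ1 : τ ≤ 1) {nn : ℕ} {m : Fin (nn + 1) → ℕ}
    (hm : CoreAdmissible τ m) (hT : 0 < T) (hTV : T ^ 3 = V) (hN : 0 < N) (hVX : X ≤ 270 * V)
    {d₀ : ℝ} (hd₀ : 0 ≤ d₀) :
    ∑ nn ∈ Nrange N ×ˢ Nrange N, |classISum X η τ m V T w N Δ₀ nn.1 nn.2| ≤
      #(Nrange N) * ∑ n ∈ (Nrange N).filter (fun n => goodCube V T N n),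
        ∑ q ∈ Icc 1 ⌊d₀⌋₊, wt Δ₀ ⌊810 * V / X⌋₊ d₀ q * Ustar (Fprim X τ m w) (LC (T / N) n) q +
      81 * TL T d₀ := by
  classical
  have hX0 : 0 < X := by linarith
  set GN := (Nrange N).filter (fun n => goodCube V T N n) with hGN
  set A : ℤ × ℤ × ℤ → ℝ := fun n =>
    ∑ q ∈ Icc 1 ⌊d₀⌋₊, wt Δ₀ ⌊810 * V / X⌋₊ d₀ q * Ustar (Fprim X τ m w) (LC (T / N) n) q with hA
  have hA0 : ∀ n, 0 ≤ A n := fun n => sum_nonneg fun q _ => mul_nonneg (wt_nonneg _ _ _ _) (Ustar_nonneg _ _ _)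
  -- restrict to good pairs
  have hzero : ∀ nn ∈ Nrange N ×ˢ Nrange N, nn ∉ GN ×ˢ GN → |classISum X η τ m V T w N Δ₀ nn.1 nn.2| = 0 := by
    intro nn hnn hnot
    rw [abs_eq_zero, classISum]
    by_cases hTI : TI X η V T N Δ₀ nn.1 nn.2 = ∅
    · rw [hTI, sum_empty]
    · exfalso
      obtain ⟨t, ht⟩ := nonempty_iff_ne_empty.mpr hTI
      rw [TI, mem_filter] at ht
      obtain ⟨hg, hg', -⟩ := goodCube_of_classI (η := η) hX0 hT hN ht.2
      rw [mem_product] at hnn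
      exact hnot (mem_product.mpr ⟨mem_filter.mpr ⟨hnn.1, hg⟩, mem_filter.mpr ⟨hnn.2, hg'⟩⟩)
  have hsubset : GN ×ˢ GN ⊆ Nrange N ×ˢ Nrange N :=
    product_subset_product (filter_subset _ _) (filter_subset _ _)
  rw [← sum_subset hsubset hzero]
  calc ∑ nn ∈ GN ×ˢ GN, |classISum X η τ m V T w N Δ₀ nn.1 nn.2|
      ≤ ∑ nn ∈ GN ×ˢ GN, ((A nn.1 + A nn.2) / 2 + 81 * tailPair T N d₀ nn.1 nn.2) :=
        sum_le_sum fun nn _ => abs_classISum_le hw hX hτ hτ1 hm hT hTV hN hVX hd₀ nn.1 nn.2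
    _ = (∑ nn ∈ GN ×ˢ GN, (A nn.1 + A nn.2)) / 2 + 81 * ∑ nn ∈ GN ×ˢ GN, tailPair T N d₀ nn.1 nn.2 := by
        rw [sum_add_distrib, sum_div, mul_sum]
    _ = (#GN * ∑ n ∈ GN, A n + #GN * ∑ n ∈ GN, A n) / 2 + 81 * ∑ nn ∈ GN ×ˢ GN, tailPair T N d₀ nn.1 nn.2 := by
        congr 2
        rw [sum_add_distrib, sum_product, sum_product]
        congr 1
        · rw [sum_comm]; simp [sum_const, nsmul_eq_mul, mul_sum]
        · simp [sum_const, nsmul_eq_mul, mul_sum]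
    _ = #GN * ∑ n ∈ GN, A n + 81 * ∑ nn ∈ GN ×ˢ GN, tailPair T N d₀ nn.1 nn.2 := by ring
    _ ≤ #(Nrange N) * ∑ n ∈ GN, A n + 81 * TL T d₀ := by
        have h1 : (#GN : ℝ) ≤ #(Nrange N) := by exact_mod_cast card_le_card (filter_subset _ _)
        have h2 := sum_tailPair_le_TL (V := V) hT hTV hN d₀
        rw [← hGN] at h2
        have h3 : 0 ≤ ∑ n ∈ GN, A n := sum_nonneg fun n _ => hA0 n
        nlinarith

end Literature.NumberTheory.Sieve.CubicSieve.Twisted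

end
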